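import Summits.QuantumFields.YangMills.Theorems.UnitScaleTiltFluctuationComparisonRegPrCertReflectKeyed

/-!
# Route `UnitScaleTilt` — crux `FluctuationComparisonRegPrL` (stmt-QuantumFields-19935), stub `stub_oneStepSmallLift`, piece (L2):
# GENERIC KERNEL-REFLECTION, part 3 — the four scalar certificate facts for ARBITRARY sparse tables (support file `--supports stmt-QuantumFields-19935`)

Fleet seat `ym-ust-19201-p2` gen 5 (OWNER RULING g20-№9 §3, task «DE-NATIVE CertL3Tree»).  For an arbitrary entry type with raw-coordinate
accessors, an arbitrary entry list `E` and any table function `KZ` (resp. `EQ`) that unfolds to the filtered look-up of `E` (hypothesis `hKZ` /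
`hEQ` — for `…CertL3Tree` these are `kzQ 3` / `eQ 3` by `rfl`), the dense statements asserted about the table (face support, S-neutrality, row
mass, chain mass) follow from ENTRY-DRIVEN finite checks (`massRowG`, `sneutRowG`, `chainRowG`, quantified over `List.finRange`) — so the data
file only instantiates and evaluates the checks by `decide +kernel`.  Table-independent; nothing of Bałaban's.
-/

open scoped BigOperators

namespace Summit.QuantumFields.YangMills.Theorems.ApproxLift.CertReflect

open Summit.QuantumFields.YangMills.Theorems.ApproxLift

section KTable

variable {α : Type*} (fa fp0 fp1 fp2 fo fk0 fk1 fk2 : α → ℕ) (fv : α → ℤ) (oi : Orient 3 → ℕ)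

/-- ENTRY-DRIVEN row mass of `(a, p)`: the `ℓ¹` mass of the entries with direction `a` and offsets `p`. -/
def massRowG (E : List α) (a : Fin 3) (p : Fin 3 → Fin 3) : ℚ :=
  (E.map fun e => if fa e = (a : ℕ) ∧ fp0 e = (p 0 : ℕ) ∧ fp1 e = (p 1 : ℕ) ∧ fp2 e = (p 2 : ℕ) then |(fv e : ℚ)| else 0).sum

/-- ENTRY-DRIVEN S-neutrality sum of `(a, o, k)`: thrice the sum of the entries with direction `a`, orientation `o`, displacement `k` on the
face `offs[a] = 2` (the factor `3` counts the free `a`-th offset). -/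
def sneutRowG (E : List α) (a : Fin 3) (o : Orient 3) (k : Fin 3 → Fin (2 * 2 + 1)) : ℚ :=
  (E.map fun e =>
    if fk0 e = (k 0 : ℕ) ∧ fk1 e = (k 1 : ℕ) ∧ fk2 e = (k 2 : ℕ) ∧ fa e = (a : ℕ) ∧ fo e = oi o ∧
        ((![fp0 e, fp1 e, fp2 e] : Fin 3 → ℕ) a) = ((⟨3 - 1, by decide⟩ : Fin 3) : ℕ)
    then 3 * (fv e : ℚ) else 0).sum

/-- **FACE SUPPORT, GENERIC**: if every entry lies on the exit face of its own direction, the table vanishes off that face. -/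
theorem face_of_entries (E : List α) (c : ℚ)
    (KZ : Fin 3 → (Fin 3 → Fin 3) → Orient 3 → (Fin 3 → Fin (2 * 2 + 1)) → ℚ)
    (hKZ : ∀ (a : Fin 3) (p : Fin 3 → Fin 3) (o : Orient 3) (k : Fin 3 → Fin (2 * 2 + 1)),
      KZ a p o k = ((E.filter fun e => (fa e == (a : ℕ) && fp0 e == (p 0 : ℕ) && fp1 e == (p 1 : ℕ) && fp2 e == (p 2 : ℕ) && fo e == oi o &&
          fk0 e == (k 0 : ℕ) && fk1 e == (k 1 : ℕ) && fk2 e == (k 2 : ℕ))).map fun e => (fv e : ℚ)).sum / c)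
    (hface : ∀ e ∈ E, (fa e = 0 → fp0 e = 2) ∧ (fa e = 1 → fp1 e = 2) ∧ (fa e = 2 → fp2 e = 2))
    (a : Fin 3) (p : Fin 3 → Fin 3) (o : Orient 3) (k : Fin 3 → Fin (2 * 2 + 1)) (hpa : (p a : ℕ) ≠ 3 - 1) : KZ a p o k = 0 := by
  rw [hKZ, List.filter_eq_nil_iff.2, List.map_nil, List.sum_nil, zero_div]
  intro e he hm
  obtain ⟨h1, h2, h3, h4, -, -, -, -⟩ := (mk_iff fa fp0 fp1 fp2 fo fk0 fk1 fk2 oi e a p o k).1 hm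
  obtain ⟨f0, f1, f2⟩ := hface e he
  have ha3 : (a : ℕ) = 0 ∨ (a : ℕ) = 1 ∨ (a : ℕ) = 2 := by have := a.isLt; omega
  rcases ha3 with h0 | h0 | h0
  · have ha : a = 0 := Fin.ext h0
    subst ha
    exact hpa (by have := f0 (h1.trans h0); omega)
  · have ha : a = 1 := Fin.ext h0
    subst ha
    exact hpa (by have := f1 (h1.trans h0); omega)
  · have ha : a = 2 := Fin.ext h0
    subst ha
    exact hpa (by have := f2 (h1.trans h0); omega)

/-- **S-NEUTRALITY, GENERIC**: the face sums of the table vanish once the entry-driven sums `sneutRowG` do. -/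
theorem sneutral_of_entries (E : List α) (hE : ∀ e ∈ E, fp0 e < 3 ∧ fp1 e < 3 ∧ fp2 e < 3) (c : ℚ)
    (KZ : Fin 3 → (Fin 3 → Fin 3) → Orient 3 → (Fin 3 → Fin (2 * 2 + 1)) → ℚ)
    (hKZ : ∀ (a : Fin 3) (p : Fin 3 → Fin 3) (o : Orient 3) (k : Fin 3 → Fin (2 * 2 + 1)),
      KZ a p o k = ((E.filter fun e => (fa e == (a : ℕ) && fp0 e == (p 0 : ℕ) && fp1 e == (p 1 : ℕ) && fp2 e == (p 2 : ℕ) && fo e == oi o &&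
          fk0 e == (k 0 : ℕ) && fk1 e == (k 1 : ℕ) && fk2 e == (k 2 : ℕ))).map fun e => (fv e : ℚ)).sum / c)
    (hc : ∀ a ∈ List.finRange 3, ∀ x ∈ List.finRange (2 * 2 + 1), ∀ y ∈ List.finRange (2 * 2 + 1), ∀ z ∈ List.finRange (2 * 2 + 1),
      sneutRowG fa fp0 fp1 fp2 fo fk0 fk1 fk2 fv oi E a ⟨(0, 1), by decide⟩ ![x, y, z] = 0 ∧
        sneutRowG fa fp0 fp1 fp2 fo fk0 fk1 fk2 fv oi E a ⟨(0, 2), by decide⟩ ![x, y, z] = 0 ∧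
        sneutRowG fa fp0 fp1 fp2 fo fk0 fk1 fk2 fv oi E a ⟨(1, 2), by decide⟩ ![x, y, z] = 0)
    (a : Fin 3) (o : Orient 3) (k : Fin 3 → Fin (2 * 2 + 1)) :
    ∑ r : Fin 3 → Fin 3, KZ a (Function.update r a (⟨3 - 1, by decide⟩ : Fin 3)) o k = 0 := by
  have hcheck : ∀ (a : Fin 3) (o : Orient 3) (k : Fin 3 → Fin (2 * 2 + 1)), sneutRowG fa fp0 fp1 fp2 fo fk0 fk1 fk2 fv oi E a o k = 0 := by
    intro a o k
    revert o
    refine forall_orient3.2 ?_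
    revert k
    refine forall_pi3.2 fun x y z => ?_
    exact hc a (List.mem_finRange a) x (List.mem_finRange x) y (List.mem_finRange y) z (List.mem_finRange z)
  rw [Finset.sum_congr rfl fun r _ => (hKZ a (Function.update r a (⟨3 - 1, by decide⟩ : Fin 3)) o k).trans
      (congrArg (· / c) (sum_map_filter _ _ _)), ← Finset.sum_div, finset_sum_list_sum]
  have key : ∀ e ∈ E, (∑ r : Fin 3 → Fin 3,
      if (fa e == (a : ℕ) && fp0 e == (Function.update r a (⟨3 - 1, by decide⟩ : Fin 3) 0 : ℕ) && fp1 e == (Function.update r a (⟨3 - 1, by decide⟩ : Fin 3) 1 : ℕ) &&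
          fp2 e == (Function.update r a (⟨3 - 1, by decide⟩ : Fin 3) 2 : ℕ) && fo e == oi o &&
          fk0 e == (k 0 : ℕ) && fk1 e == (k 1 : ℕ) && fk2 e == (k 2 : ℕ)) = true then (fv e : ℚ) else 0) =
      if fk0 e = (k 0 : ℕ) ∧ fk1 e = (k 1 : ℕ) ∧ fk2 e = (k 2 : ℕ) ∧ fa e = (a : ℕ) ∧ fo e = oi o ∧
          ((![fp0 e, fp1 e, fp2 e] : Fin 3 → ℕ) a) = ((⟨3 - 1, by decide⟩ : Fin 3) : ℕ)
      then 3 * (fv e : ℚ) else 0 := by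
    intro e he
    obtain ⟨hp0, hp1, hp2⟩ := hE e he
    obtain ⟨p₀, e0, e1, e2⟩ := exists_vec3 _ _ _ hp0 hp1 hp2
    exact collapse_update fa fp0 fp1 fp2 fo fk0 fk1 fk2 oi e (fv e : ℚ) a _ o k p₀ e0 e1 e2
  exact div_eq_zero_iff.2 (Or.inl ((congrArg List.sum (List.map_congr_left key)).trans (hcheck a o k)))

/-- **ROW MASS, GENERIC**: `Σ_{o,k} |table| ≤ B / c` once every entry-driven row mass is `≤ B`. -/
theorem mass_of_entries (hoi : Function.Injective oi) (hos : ∀ n, n < 3 → ∃ o : Orient 3, oi o = n) (E : List α)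
    (hE : ∀ e ∈ E, fo e < 3 ∧ fk0 e < 2 * 2 + 1 ∧ fk1 e < 2 * 2 + 1 ∧ fk2 e < 2 * 2 + 1) (c : ℚ)
    (KZ : Fin 3 → (Fin 3 → Fin 3) → Orient 3 → (Fin 3 → Fin (2 * 2 + 1)) → ℚ)
    (hKZ : ∀ (a : Fin 3) (p : Fin 3 → Fin 3) (o : Orient 3) (k : Fin 3 → Fin (2 * 2 + 1)),
      KZ a p o k = ((E.filter fun e => (fa e == (a : ℕ) && fp0 e == (p 0 : ℕ) && fp1 e == (p 1 : ℕ) && fp2 e == (p 2 : ℕ) && fo e == oi o &&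
          fk0 e == (k 0 : ℕ) && fk1 e == (k 1 : ℕ) && fk2 e == (k 2 : ℕ))).map fun e => (fv e : ℚ)).sum / c)
    (B : ℚ) (hcpos : 0 < c)
    (hc : ∀ a ∈ List.finRange 3, ∀ x ∈ List.finRange 3, ∀ y ∈ List.finRange 3, ∀ z ∈ List.finRange 3,
      massRowG fa fp0 fp1 fp2 fv E a ![x, y, z] ≤ B)
    (a : Fin 3) (p : Fin 3 → Fin 3) :
    ∑ o : Orient 3, ∑ k : Fin 3 → Fin (2 * 2 + 1), |KZ a p o k| ≤ B / c := by
  have hcheck : ∀ (a : Fin 3) (p : Fin 3 → Fin 3), massRowG fa fp0 fp1 fp2 fv E a p ≤ B := fun a =>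
    forall_pi3.2 fun x y z => hc a (List.mem_finRange a) x (List.mem_finRange x) y (List.mem_finRange y) z (List.mem_finRange z)
  have hpt : ∀ (o : Orient 3) (k : Fin 3 → Fin (2 * 2 + 1)), |KZ a p o k| ≤
      (E.map fun e => if (fa e == (a : ℕ) && fp0 e == (p 0 : ℕ) && fp1 e == (p 1 : ℕ) && fp2 e == (p 2 : ℕ) && fo e == oi o &&
          fk0 e == (k 0 : ℕ) && fk1 e == (k 1 : ℕ) && fk2 e == (k 2 : ℕ)) = true then |(fv e : ℚ)| else 0).sum / c := by
    intro o k
    rw [hKZ, sum_map_filter, abs_div, abs_of_pos hcpos]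
    gcongr
    refine (abs_sum_map_le _ _).trans (le_of_eq (congrArg List.sum (List.map_congr_left fun e _ => ?_)))
    split_ifs <;> simp
  have key : ∀ e ∈ E, (∑ o : Orient 3, ∑ k : Fin 3 → Fin (2 * 2 + 1), if (fa e == (a : ℕ) && fp0 e == (p 0 : ℕ) && fp1 e == (p 1 : ℕ) && fp2 e == (p 2 : ℕ) && fo e == oi o &&
          fk0 e == (k 0 : ℕ) && fk1 e == (k 1 : ℕ) && fk2 e == (k 2 : ℕ)) = true then |(fv e : ℚ)| else 0) =
      if fa e = (a : ℕ) ∧ fp0 e = (p 0 : ℕ) ∧ fp1 e = (p 1 : ℕ) ∧ fp2 e = (p 2 : ℕ) then |(fv e : ℚ)| else 0 := by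
    intro e he
    obtain ⟨ho, hk0, hk1, hk2⟩ := hE e he
    obtain ⟨o₀, hoo⟩ := hos _ ho
    obtain ⟨k₀, e0, e1, e2⟩ := exists_vec3 _ _ _ hk0 hk1 hk2
    exact collapse_ok fa fp0 fp1 fp2 fo fk0 fk1 fk2 oi hoi e (fun _ _ => |(fv e : ℚ)|) a p o₀ k₀ hoo.symm e0 e1 e2
  calc ∑ o : Orient 3, ∑ k : Fin 3 → Fin (2 * 2 + 1), |KZ a p o k|
      ≤ ∑ o : Orient 3, ∑ k : Fin 3 → Fin (2 * 2 + 1), (E.map fun e => if (fa e == (a : ℕ) && fp0 e == (p 0 : ℕ) && fp1 e == (p 1 : ℕ) && fp2 e == (p 2 : ℕ) && fo e == oi o &&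
          fk0 e == (k 0 : ℕ) && fk1 e == (k 1 : ℕ) && fk2 e == (k 2 : ℕ)) = true then |(fv e : ℚ)| else 0).sum / c :=
        Finset.sum_le_sum fun o _ => Finset.sum_le_sum fun k _ => hpt o k
    _ = massRowG fa fp0 fp1 fp2 fv E a p / c := by
        simp_rw [← Finset.sum_div]
        congr 1
        simp_rw [finset_sum_list_sum]
        exact congrArg List.sum (List.map_congr_left key)
    _ ≤ B / c := by gcongr; exact hcheck a p

end KTable

section ETable

variable {β : Type*} (gop gq0 gq1 gq2 gm0 gm1 gm2 : β → ℕ) (fv' : β → ℤ) (oi : Orient 3 → ℕ)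

/-- ENTRY-DRIVEN chain mass of a class. -/
def chainRowG (E' : List β) (μ ν : Fin 3) (h : μ < ν) (pp : Fin 3 → Fin 3) : ℚ :=
  (E'.map fun e => if gop e = oi ⟨(μ, ν), h⟩ ∧ gq0 e = (pp 0 : ℕ) ∧ gq1 e = (pp 1 : ℕ) ∧ gq2 e = (pp 2 : ℕ) then |(fv' e : ℚ)| else 0).sum

/-- **CHAIN MASS, GENERIC**: `Σ_{τ,q} |chain table| ≤ B / c'` once every entry-driven chain mass is `≤ B`. -/
theorem chainMass_of_entries
    (E' : List β) (hE' : ∀ e ∈ E', gm0 e < 2 * (2 + 1) + 1 ∧ gm1 e < 2 * (2 + 1) + 1 ∧ gm2 e < 2 * (2 + 1) + 1) (c' : ℚ)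
    (EQ : ∀ μ ν : Fin 3, μ < ν → (Fin 3 → Fin 3) → Tri 3 → (Fin 3 → Fin (2 * (2 + 1) + 1)) → ℚ)
    (hEQ : ∀ (μ ν : Fin 3) (h : μ < ν) (pp : Fin 3 → Fin 3) (τ : Tri 3) (q : Fin 3 → Fin (2 * (2 + 1) + 1)),
      EQ μ ν h pp τ q = ((E'.filter fun e => (gop e == oi ⟨(μ, ν), h⟩ && gq0 e == (pp 0 : ℕ) && gq1 e == (pp 1 : ℕ) && gq2 e == (pp 2 : ℕ) &&
          gm0 e == (q 0 : ℕ) && gm1 e == (q 1 : ℕ) && gm2 e == (q 2 : ℕ))).map fun e => (fv' e : ℚ)).sum / c')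
    (B : ℚ) (hcpos : 0 < c')
    (hc : ∀ x ∈ List.finRange 3, ∀ y ∈ List.finRange 3, ∀ z ∈ List.finRange 3,
      chainRowG gop gq0 gq1 gq2 fv' oi E' 0 1 (by decide) ![x, y, z] ≤ B ∧ chainRowG gop gq0 gq1 gq2 fv' oi E' 0 2 (by decide) ![x, y, z] ≤ B ∧
        chainRowG gop gq0 gq1 gq2 fv' oi E' 1 2 (by decide) ![x, y, z] ≤ B)
    (μ ν : Fin 3) (h : μ < ν) (pp : Fin 3 → Fin 3) :
    ∑ τ : Tri 3, ∑ q : Fin 3 → Fin (2 * (2 + 1) + 1), |EQ μ ν h pp τ q| ≤ B / c' := by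
  have hcheck : ∀ (μ ν : Fin 3) (h : μ < ν) (pp : Fin 3 → Fin 3), chainRowG gop gq0 gq1 gq2 fv' oi E' μ ν h pp ≤ B := by
    refine forall_lt3.2 ⟨?_, ?_, ?_⟩ <;> refine forall_pi3.2 fun x y z => ?_
    · exact (hc x (List.mem_finRange x) y (List.mem_finRange y) z (List.mem_finRange z)).1
    · exact (hc x (List.mem_finRange x) y (List.mem_finRange y) z (List.mem_finRange z)).2.1
    · exact (hc x (List.mem_finRange x) y (List.mem_finRange y) z (List.mem_finRange z)).2.2
  rw [sum_tri3]
  have hpt : ∀ q : Fin 3 → Fin (2 * (2 + 1) + 1), |EQ μ ν h pp (⟨(0, 1, 2), by decide, by decide⟩ : Tri 3) q| ≤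
      (E'.map fun e => if (gop e == oi ⟨(μ, ν), h⟩ && gq0 e == (pp 0 : ℕ) && gq1 e == (pp 1 : ℕ) && gq2 e == (pp 2 : ℕ) &&
          gm0 e == (q 0 : ℕ) && gm1 e == (q 1 : ℕ) && gm2 e == (q 2 : ℕ)) = true then |(fv' e : ℚ)| else 0).sum / c' := by
    intro q
    rw [hEQ, sum_map_filter, abs_div, abs_of_pos hcpos]
    gcongr
    refine (abs_sum_map_le _ _).trans (le_of_eq (congrArg List.sum (List.map_congr_left fun e _ => ?_)))
    split_ifs <;> simp
  have key : ∀ e ∈ E', (∑ q : Fin 3 → Fin (2 * (2 + 1) + 1), if (gop e == oi ⟨(μ, ν), h⟩ && gq0 e == (pp 0 : ℕ) && gq1 e == (pp 1 : ℕ) && gq2 e == (pp 2 : ℕ) &&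
          gm0 e == (q 0 : ℕ) && gm1 e == (q 1 : ℕ) && gm2 e == (q 2 : ℕ)) = true then |(fv' e : ℚ)| else 0) =
      if gop e = oi ⟨(μ, ν), h⟩ ∧ gq0 e = (pp 0 : ℕ) ∧ gq1 e = (pp 1 : ℕ) ∧ gq2 e = (pp 2 : ℕ) then |(fv' e : ℚ)| else 0 := by
    intro e he
    obtain ⟨hm0, hm1, hm2⟩ := hE' e he
    obtain ⟨q₀, e0, e1, e2⟩ := exists_vec3 _ _ _ hm0 hm1 hm2
    exact collapseE gop gq0 gq1 gq2 gm0 gm1 gm2 oi e (fun _ => |(fv' e : ℚ)|) μ ν h pp q₀ e0 e1 e2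
  calc ∑ q : Fin 3 → Fin (2 * (2 + 1) + 1), |EQ μ ν h pp (⟨(0, 1, 2), by decide, by decide⟩ : Tri 3) q|
      ≤ ∑ q : Fin 3 → Fin (2 * (2 + 1) + 1), (E'.map fun e => if (gop e == oi ⟨(μ, ν), h⟩ && gq0 e == (pp 0 : ℕ) && gq1 e == (pp 1 : ℕ) && gq2 e == (pp 2 : ℕ) &&
          gm0 e == (q 0 : ℕ) && gm1 e == (q 1 : ℕ) && gm2 e == (q 2 : ℕ)) = true then |(fv' e : ℚ)| else 0).sum / c' :=
        Finset.sum_le_sum fun q _ => hpt q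
    _ = chainRowG gop gq0 gq1 gq2 fv' oi E' μ ν h pp / c' := by
        rw [← Finset.sum_div]
        congr 1
        rw [finset_sum_list_sum]
        exact congrArg List.sum (List.map_congr_left key)
    _ ≤ B / c' := by gcongr; exact hcheck μ ν h pp

end ETable

end Summit.QuantumFields.YangMills.Theorems.ApproxLift.CertReflect
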